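import Literature.AlgebraicGeometry.Motives.WeilDiscriminant
import Literature.AlgebraicGeometry.Motives.WeilDiscriminantProduct
import HarnessLib

/-!
# Ring 2 · transport (gen 58) — DISCRIMINANT SATURATION on a rank-one `K`-stable factor (Schoen 1998 §8 with `g = 1`)

HONEST FRAMING: research route conditional on HC_CM; not a corollary; Q11.4-sentence-2 already refuted in dim ≥ 3.

Cell `pub-hodge-ring2`, seat `pub-hodge-ring2-transport-g58` (markdown half:
`HOME/pub-hodge-ring2-transport-g58/records/T58-DEGCM-SATURATION.md`). Pure linear algebra over the tree's
discriminant infrastructure (`Literature.AlgebraicGeometry.Motives.weilHermitianForm` / `weilDiscriminant` /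
`bilinOrthSum`, van Geemen 1994 Lemma 5.2; Schoen 1998 §§2, 8, 10). NO abelian varieties, NO named Literature
fact, NO `HC_CM` (KIND of `HC_CM` = ABSENT), 0 `def`, 0 `sorry`.

The printed sentence (C. Schoen, *Addendum to: Hodge classes on self-products of a variety with an
automorphism*, Compositio Math. 114 (1998) 329–336, §8, p. 332, verbatim): "Let `(V_ℤ, β)` be a Weil pair of
rank `g`. By replacing `β` by `aβ` with `a` a positive integer, we change the discriminant invariant from `f` to
`a^g f`. If `g` is even, this operation has no effect on `f`. However if `g` is odd, any element
`h ∈ ℚ^×/N_ℚ^K K^×` with `sign(h) = sign(f)` has the form `a^g f` for an appropriate choice of `a`." Combined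
with the multiplicativity of the discriminant over orthogonal sums (§10, tree theorem
`Motives.weilDiscriminant_bilinOrthSum`) this gives the SATURATION used in T58: if the polarization form is an
orthogonal sum `E₁ ⊕ E₂` with `E₁` on a `K`-LINE (`dim_K V₁ = 1`, e.g. `H₁` of a `K`-stable elliptic factor
with CM by `K`), then rescaling `E₁` alone by `c` multiplies the discriminant by the class of `c`, so the
discriminants of the forms `(c E₁) ⊕ E₂`, `c ∈ ℚ_{>0}` (equivalently `c` a positive INTEGER), fill the whole
coset `[ℚ_{>0}] · disc(E₁ ⊕ E₂)` of `ℚˣ ⧸ Nm(Kˣ)` — for `K` imaginary quadratic, every class of the same sign.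

## What is here (everything PROVED)
* §1 `weilDiscriminant_smul_form_eq_pow_mul` — `disc(c E) = [c ^ dim_K V] · disc(E)` whenever `det Ψ_E ∈ ℚˣ`;
  `…_of_weil` (van Geemen's standing hypotheses discharge `det Ψ_E ∈ ℚˣ`); `…_of_finrank_eq_one_of_weil`
  (`dim_K V = 1`: `disc(c E) = [c] · disc(E)` — Schoen §8 with `g = 1`).
* §2 `nondegenerate_smul_of_ne_zero` — `c E` is non-degenerate for `c ≠ 0` (API helper).
* §3 `weilDiscriminant_bilinOrthSum_smul_left_of_finrank_eq_one` — `disc((c E₁) ⊕ E₂) = [c] · disc(E₁ ⊕ E₂)`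
  for `dim_K V₁ = 1`.
* §4 `exists_pos_nat_mk_eq_mk_of_pos` — for `[K : ℚ] = 2`, every POSITIVE rational has the class of a positive
  INTEGER in `ℚˣ ⧸ Nm(Kˣ)` (`p/q ∼ pq`, squares being norms).
* §5 `weilDiscriminant_saturation_rat` / `weilDiscriminant_saturation_nat` — every class `[q] · disc(E₁ ⊕ E₂)`,
  `q ∈ ℚ_{>0}`, is `disc((c E₁) ⊕ E₂)` for some rational `c > 0`, resp. some integer `c ≥ 1`.
Not here (cited in the markdown half only): Schoen 1998 §§6–7 (isometry classes ↔ (signature, discriminant),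
isogenies of 'universal' families) and §§11–13 (every fibre of the rank-6 family `(3; f_Prym)` has algebraic
Weil cohomology); the identification of `H₁` of a product abelian variety with the orthogonal sum of the factors'
Weil pairs (no Riemann form on the tree's real carriers).

## References
* [Schoen1998HodgeWeilAddendum] C. Schoen, Compositio Math. 114 (1998) 329–336, §2, §8, §10.
* [vanGeemen1994HodgeAV] B. van Geemen, LNM 1594 (1994), Lemma 5.2, 5.4.
* [Markman2025SecantWeil] E. Markman, arXiv:2502.03415, §1.1 and Cor. 1.6.1 (the same product move).
-/

noncomputable section

set_option linter.dupNamespace false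

open Module
open scoped Matrix

namespace Summit.HodgeConjecture.HodgeConjecture.Ring2Transport

open Literature.AlgebraicGeometry.Motives

universe u

/-! ### §1 Rescaling the form on a space of `K`-rank `g`: `disc(c E) = [c ^ g] · disc(E)` -/

section SmulForm

variable {K : Type*} [Field K] [Algebra ℚ K] {V : Type u} [AddCommGroup V] [Module ℚ V] [Module K V]

/-- The Gram matrix of `H_{cE}` is `c` times that of `H_E` (`H` is `ℚ`-linear in `E`). [folklore] -/
theorem gramMatrix_weilHermitianForm_smul_form {ι : Type*} (E : LinearMap.BilinForm ℚ V) (c : ℚ) (α : K)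
    (b : ι → V) :
    gramMatrix (weilHermitianForm (c • E) α) b = algebraMap ℚ K c • gramMatrix (weilHermitianForm E α) b := by
  ext i j
  simp only [gramMatrix_apply, Matrix.smul_apply, smul_eq_mul, weilHermitianForm_apply,
    LinearMap.smul_apply, map_mul]
  ring

/-- **`disc(c E) = [c ^ dim_K V] · disc(E)`** in `ℚˣ ⧸ Nm(Kˣ)` (`c ∈ ℚˣ`), whenever the Gram determinant of
`H_E` is a non-zero rational (van Geemen 5.2 (3)): `Ψ_{cE} = c Ψ_E`, `det Ψ_{cE} = c^{dim_K V} det Ψ_E`.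
(Schoen 1998 §8: "we change the discriminant invariant from `f` to `a^g f`".)
[cite: Schoen1998HodgeWeilAddendum, §8] -/
theorem weilDiscriminant_smul_form_eq_pow_mul [Module.Finite K V] (E : LinearMap.BilinForm ℚ V) (α : K)
    (c : ℚˣ)
    (hE : ∃ u : ℚˣ, algebraMap ℚ K u = (gramMatrix (weilHermitianForm E α) ⇑(Module.finBasis K V)).det) :
    weilDiscriminant ((c : ℚ) • E) α =
      (QuotientGroup.mk (c ^ Module.finrank K V) : ℚˣ ⧸ normUnitsSubgroup ℚ K) * weilDiscriminant E α := by
  obtain ⟨u, hu⟩ := hE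
  rw [weilDiscriminant_def, weilDiscriminant_def, gramMatrix_weilHermitianForm_smul_form, Matrix.det_smul,
    Fintype.card_fin, ← hu, ← map_pow, ← Units.val_pow_eq_pow_val,
    normResidueClass_algebraMap_mul_algebraMap, normResidueClass_algebraMap, normResidueClass_algebraMap]

variable [IsScalarTower ℚ K V]

/-- `disc(c E) = [c ^ dim_K V] · disc(E)` under van Geemen's standing hypotheses (`K = ℚ + ℚα`, `α² = -d < 0`,
`σ α = -α`, `E` alternating, non-degenerate, of Weil type), which put `det Ψ_E` in `ℚˣ`
(`exists_units_algebraMap_eq_det_gramMatrix`). [cite: Schoen1998HodgeWeilAddendum, §8] -/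
theorem weilDiscriminant_smul_form_eq_pow_mul_of_weil [Module.Finite K V] (E : LinearMap.BilinForm ℚ V)
    {α : K} {d : ℚ} (σ : K →+* K) (hd : 0 < d) (hα : α * α = algebraMap ℚ K (-d))
    (hE : ∀ x y : V, E y x = -E x y) (hW : ∀ x y : V, E (α • x) (α • y) = d * E x y)
    (hN : E.Nondegenerate) (hσα : σ α = -α)
    (hK : ∀ k : K, ∃ a b : ℚ, k = algebraMap ℚ K a + algebraMap ℚ K b * α) (c : ℚˣ) :
    weilDiscriminant ((c : ℚ) • E) α =
      (QuotientGroup.mk (c ^ Module.finrank K V) : ℚˣ ⧸ normUnitsSubgroup ℚ K) * weilDiscriminant E α :=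
  weilDiscriminant_smul_form_eq_pow_mul E α c
    (exists_units_algebraMap_eq_det_gramMatrix E σ hd hα hE hW hN hσα hK (Module.finBasis K V))

/-- **Schoen 1998 §8 with `g = 1`**: on a `K`-LINE (`dim_K V = 1`), `disc(c E) = [c] · disc(E)` — rescaling the
polarization of a rank-one Weil pair moves its discriminant by the class of the scaling factor.
[cite: Schoen1998HodgeWeilAddendum, §8] -/
theorem weilDiscriminant_smul_form_of_finrank_eq_one_of_weil [Module.Finite K V]
    (h1 : Module.finrank K V = 1) (E : LinearMap.BilinForm ℚ V)
    {α : K} {d : ℚ} (σ : K →+* K) (hd : 0 < d) (hα : α * α = algebraMap ℚ K (-d))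
    (hE : ∀ x y : V, E y x = -E x y) (hW : ∀ x y : V, E (α • x) (α • y) = d * E x y)
    (hN : E.Nondegenerate) (hσα : σ α = -α)
    (hK : ∀ k : K, ∃ a b : ℚ, k = algebraMap ℚ K a + algebraMap ℚ K b * α) (c : ℚˣ) :
    weilDiscriminant ((c : ℚ) • E) α =
      (QuotientGroup.mk c : ℚˣ ⧸ normUnitsSubgroup ℚ K) * weilDiscriminant E α := by
  rw [weilDiscriminant_smul_form_eq_pow_mul_of_weil E σ hd hα hE hW hN hσα hK c, h1, pow_one]

end SmulForm

/-! ### §2 Rescaled forms stay non-degenerate -/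

section Nondeg

variable {V : Type u} [AddCommGroup V] [Module ℚ V]

/-- `c E` is non-degenerate when `E` is and `c ≠ 0` (API helper). [folklore] -/
theorem nondegenerate_smul_of_ne_zero (E : LinearMap.BilinForm ℚ V) (hN : E.Nondegenerate) {c : ℚ}
    (hc : c ≠ 0) : ((c • E : LinearMap.BilinForm ℚ V)).Nondegenerate := by
  refine ⟨fun x hx => hN.1 x fun y => ?_, fun y hy => hN.2 y fun x => ?_⟩
  · have h : (c • E) x y = 0 := hx y
    rw [LinearMap.smul_apply, LinearMap.smul_apply, smul_eq_mul] at h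
    exact (mul_eq_zero.mp h).resolve_left hc
  · have h : (c • E) x y = 0 := hy x
    rw [LinearMap.smul_apply, LinearMap.smul_apply, smul_eq_mul] at h
    exact (mul_eq_zero.mp h).resolve_left hc

end Nondeg

/-! ### §3 Orthogonal sums with a rescaled rank-one summand -/

section OrthSum

variable {K : Type*} [Field K] [Algebra ℚ K] {V₁ : Type u} {V₂ : Type u} [AddCommGroup V₁]
  [Module ℚ V₁] [Module K V₁] [AddCommGroup V₂] [Module ℚ V₂] [Module K V₂]
  [IsScalarTower ℚ K V₁]

/-- **`disc((c E₁) ⊕ E₂) = [c] · disc(E₁ ⊕ E₂)`** when `E₁` lives on a `K`-LINE (`dim_K V₁ = 1`): the product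
polarization with the rank-one `K`-stable factor rescaled by `c ∈ ℚˣ` (Schoen 1998 §8 (`g = 1`) + §10
(`disc` multiplicative over `ψ_A ⊕ ψ'`)). Hypotheses: van Geemen's standing ones on `(K, α, σ)` and on each
`Eᵢ` (alternating, Weil type, non-degenerate). [cite: Schoen1998HodgeWeilAddendum, §8 and §10 (proof of the Proposition)] -/
theorem weilDiscriminant_bilinOrthSum_smul_left_of_finrank_eq_one [Module.Finite K V₁] [Module.Finite K V₂]
    (h1 : Module.finrank K V₁ = 1) (E₁ : LinearMap.BilinForm ℚ V₁) (E₂ : LinearMap.BilinForm ℚ V₂)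
    {α : K} {d : ℚ} (σ : K →+* K) (hd : 0 < d) (hα : α * α = algebraMap ℚ K (-d)) (hσα : σ α = -α)
    (hK : ∀ k : K, ∃ a b : ℚ, k = algebraMap ℚ K a + algebraMap ℚ K b * α)
    (hσ : ∀ k : K, k * σ k = algebraMap ℚ K (Algebra.norm ℚ k))
    (hE₁ : ∀ x y : V₁, E₁ y x = -E₁ x y) (hW₁ : ∀ x y : V₁, E₁ (α • x) (α • y) = d * E₁ x y)
    (hN₁ : E₁.Nondegenerate)
    (hE₂ : ∀ x y : V₂, E₂ y x = -E₂ x y) (hW₂ : ∀ x y : V₂, E₂ (α • x) (α • y) = d * E₂ x y)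
    (hN₂ : E₂.Nondegenerate) (c : ℚˣ) :
    weilDiscriminant (bilinOrthSum ((c : ℚ) • E₁) E₂) α =
      (QuotientGroup.mk c : ℚˣ ⧸ normUnitsSubgroup ℚ K) * weilDiscriminant (bilinOrthSum E₁ E₂) α := by
  have hE₁' : ∀ x y : V₁, ((c : ℚ) • E₁) y x = -((c : ℚ) • E₁) x y := fun x y => by
    simp only [LinearMap.smul_apply, smul_eq_mul, hE₁ x y, mul_neg]
  have hW₁' : ∀ x y : V₁, ((c : ℚ) • E₁) (α • x) (α • y) = d * ((c : ℚ) • E₁) x y := fun x y => by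
    simp only [LinearMap.smul_apply, smul_eq_mul, hW₁ x y]
    ring
  have hN₁' : (((c : ℚ) • E₁ : LinearMap.BilinForm ℚ V₁)).Nondegenerate :=
    nondegenerate_smul_of_ne_zero E₁ hN₁ c.ne_zero
  rw [weilDiscriminant_bilinOrthSum _ _ σ hd hα hσα hK hσ hE₁' hW₁' hN₁' hE₂ hW₂ hN₂,
    weilDiscriminant_bilinOrthSum _ _ σ hd hα hσα hK hσ hE₁ hW₁ hN₁ hE₂ hW₂ hN₂,
    weilDiscriminant_smul_form_of_finrank_eq_one_of_weil h1 E₁ σ hd hα hE₁ hW₁ hN₁ hσα hK c, mul_assoc]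

end OrthSum

/-! ### §4 Positive rationals have positive-integer representatives modulo norms from a quadratic field -/

section NatRep

variable {K : Type*} [Field K] [Algebra ℚ K]

/-- For `[K : ℚ] = 2`, every positive rational `q = n/m` has the class of the positive INTEGER `n m` in
`ℚˣ ⧸ Nm(Kˣ)`: `q⁻¹ · n m = m² = Nm(m)`. (So "`a` a positive integer" in Schoen §8 loses nothing against
`a ∈ ℚ_{>0}`.) [folklore] -/
theorem exists_pos_nat_mk_eq_mk_of_pos (hK : Module.finrank ℚ K = 2) (q : ℚˣ) (hq : 0 < (q : ℚ)) :
    ∃ a : ℕ, 0 < a ∧ ∃ ha : (a : ℚ) ≠ 0,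
      (QuotientGroup.mk (Units.mk0 (a : ℚ) ha) : ℚˣ ⧸ normUnitsSubgroup ℚ K) = QuotientGroup.mk q := by
  set r : ℚ := (q : ℚ) with hr
  have hn : 0 < r.num := Rat.num_pos.mpr hq
  have hm : 0 < r.den := r.den_pos
  have hnq : ((r.num.toNat : ℕ) : ℚ) = (r.num : ℚ) := by
    rw [← Int.cast_natCast, Int.toNat_of_nonneg hn.le]
  have ha0 : ((r.num.toNat * r.den : ℕ) : ℚ) ≠ 0 := by
    rw [Nat.cast_mul, hnq]
    exact mul_ne_zero (by exact_mod_cast hn.ne') (by exact_mod_cast hm.ne')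
  refine ⟨r.num.toNat * r.den, Nat.mul_pos (by omega) hm, ha0, ?_⟩
  rw [QuotientGroup.eq]
  have hm0 : ((r.den : ℕ) : ℚ) ≠ 0 := by exact_mod_cast hm.ne'
  have key : (Units.mk0 ((r.num.toNat * r.den : ℕ) : ℚ) ha0)⁻¹ * q =
      (Units.mk0 (r.den : ℚ) hm0)⁻¹ ^ Module.finrank ℚ K := by
    rw [hK]
    ext
    rw [Units.val_mul, Units.val_inv_eq_inv_val, Units.val_mk0, Units.val_pow_eq_pow_val,
      Units.val_inv_eq_inv_val, Units.val_mk0, Nat.cast_mul, hnq, ← hr]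
    have hmul : r * (r.den : ℚ) = (r.num : ℚ) := Rat.mul_den_eq_num r
    have hr0 : r ≠ 0 := hq.ne'
    rw [← hmul]
    field_simp
  rw [key]
  exact pow_finrank_mem_normUnitsSubgroup _

end NatRep

/-! ### §5 Saturation: the discriminants of `(c E₁) ⊕ E₂`, `c > 0`, fill the coset `[ℚ_{>0}] · disc(E₁ ⊕ E₂)` -/

section Saturation

variable {K : Type*} [Field K] [Algebra ℚ K] {V₁ : Type u} {V₂ : Type u} [AddCommGroup V₁]
  [Module ℚ V₁] [Module K V₁] [AddCommGroup V₂] [Module ℚ V₂] [Module K V₂]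
  [IsScalarTower ℚ K V₁]

/-- **DISCRIMINANT SATURATION (rational form).** `E₁` on a `K`-line, `E₂` arbitrary (van Geemen hypotheses):
for every `q ∈ ℚ_{>0}` the class `[q] · disc(E₁ ⊕ E₂)` is the discriminant of `(c E₁) ⊕ E₂` for a rational
`c > 0` (namely `c = q`). For `K` imaginary quadratic (`Nm > 0`) the classes `[q]`, `q > 0`, are exactly the
sign-`+` classes, so every class with the sign of `disc(E₁ ⊕ E₂)` is attained (Schoen 1998 §8: "any element
`h` … with `sign(h) = sign(f)` has the form `a^g f`", here through the rank-one summand).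
[cite: Schoen1998HodgeWeilAddendum, §8 and §10 (proof of the Proposition)] -/
theorem weilDiscriminant_saturation_rat [Module.Finite K V₁] [Module.Finite K V₂]
    (h1 : Module.finrank K V₁ = 1) (E₁ : LinearMap.BilinForm ℚ V₁) (E₂ : LinearMap.BilinForm ℚ V₂)
    {α : K} {d : ℚ} (σ : K →+* K) (hd : 0 < d) (hα : α * α = algebraMap ℚ K (-d)) (hσα : σ α = -α)
    (hK : ∀ k : K, ∃ a b : ℚ, k = algebraMap ℚ K a + algebraMap ℚ K b * α)
    (hσ : ∀ k : K, k * σ k = algebraMap ℚ K (Algebra.norm ℚ k))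
    (hE₁ : ∀ x y : V₁, E₁ y x = -E₁ x y) (hW₁ : ∀ x y : V₁, E₁ (α • x) (α • y) = d * E₁ x y)
    (hN₁ : E₁.Nondegenerate)
    (hE₂ : ∀ x y : V₂, E₂ y x = -E₂ x y) (hW₂ : ∀ x y : V₂, E₂ (α • x) (α • y) = d * E₂ x y)
    (hN₂ : E₂.Nondegenerate) (q : ℚˣ) (hq : 0 < (q : ℚ)) :
    ∃ c : ℚ, 0 < c ∧ weilDiscriminant (bilinOrthSum (c • E₁) E₂) α =
      (QuotientGroup.mk q : ℚˣ ⧸ normUnitsSubgroup ℚ K) * weilDiscriminant (bilinOrthSum E₁ E₂) α :=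
  ⟨q, hq, weilDiscriminant_bilinOrthSum_smul_left_of_finrank_eq_one h1 E₁ E₂ σ hd hα hσα hK hσ hE₁ hW₁ hN₁
    hE₂ hW₂ hN₂ q⟩

/-- **DISCRIMINANT SATURATION (integer form, `[K : ℚ] = 2`).** Same, with the scaling factor a positive
INTEGER `a ≥ 1` (Schoen's "replacing `β` by `aβ` with `a` a positive integer" keeps a polarization a
polarization): `disc((a E₁) ⊕ E₂) = [q] · disc(E₁ ⊕ E₂)` for `a = num(q) · den(q)`.
[cite: Schoen1998HodgeWeilAddendum, §8 and §10 (proof of the Proposition)] -/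
theorem weilDiscriminant_saturation_nat [Module.Finite K V₁] [Module.Finite K V₂]
    (hK2 : Module.finrank ℚ K = 2)
    (h1 : Module.finrank K V₁ = 1) (E₁ : LinearMap.BilinForm ℚ V₁) (E₂ : LinearMap.BilinForm ℚ V₂)
    {α : K} {d : ℚ} (σ : K →+* K) (hd : 0 < d) (hα : α * α = algebraMap ℚ K (-d)) (hσα : σ α = -α)
    (hK : ∀ k : K, ∃ a b : ℚ, k = algebraMap ℚ K a + algebraMap ℚ K b * α)
    (hσ : ∀ k : K, k * σ k = algebraMap ℚ K (Algebra.norm ℚ k))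
    (hE₁ : ∀ x y : V₁, E₁ y x = -E₁ x y) (hW₁ : ∀ x y : V₁, E₁ (α • x) (α • y) = d * E₁ x y)
    (hN₁ : E₁.Nondegenerate)
    (hE₂ : ∀ x y : V₂, E₂ y x = -E₂ x y) (hW₂ : ∀ x y : V₂, E₂ (α • x) (α • y) = d * E₂ x y)
    (hN₂ : E₂.Nondegenerate) (q : ℚˣ) (hq : 0 < (q : ℚ)) :
    ∃ a : ℕ, 0 < a ∧ weilDiscriminant (bilinOrthSum ((a : ℚ) • E₁) E₂) α =
      (QuotientGroup.mk q : ℚˣ ⧸ normUnitsSubgroup ℚ K) * weilDiscriminant (bilinOrthSum E₁ E₂) α := by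
  obtain ⟨a, ha, ha0, hmk⟩ := exists_pos_nat_mk_eq_mk_of_pos (K := K) hK2 q hq
  refine ⟨a, ha, ?_⟩
  rw [← hmk]
  exact weilDiscriminant_bilinOrthSum_smul_left_of_finrank_eq_one h1 E₁ E₂ σ hd hα hσα hK hσ hE₁ hW₁ hN₁
    hE₂ hW₂ hN₂ (Units.mk0 (a : ℚ) ha0)

end Saturation

end Summit.HodgeConjecture.HodgeConjecture.Ring2Transport

end
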